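import Literature.Barriers.CriticalPhenomena.TimarSlabs
import Literature.Barriers.CriticalPhenomena.TimarGoodBox
import Literature.Barriers.CriticalPhenomena.SubexponentialGrowthZdCoupling
import Literature.Probability.Percolation.InsertionTolerance
import Literature.Probability.Percolation.DeletionTolerance
import HarnessLib

/-!
# Timár 2006, Lemma 5.2: a heavy cluster intersects every slab in infinitely many vertices —
# PROVED

Barrier catalogue `Literature/Barriers/CriticalPhenomena/`; second brick of the programme proving
Timár's Thm. 5.5 (`Timar2006_finiteLevelUnion`, `TimarCriticalNonunimodular.lean`). Á. Timár,
*Percolation on nonunimodular transitive graphs*, Ann. Probab. 34 (2006) 2344–2364, §5: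

> **Lemma 5.2.** A heavy cluster intersects every slab in infinitely many vertices.
>
> *Proof.* Otherwise, by deletion tolerance, with positive probability there would be a heavy
> cluster that does not have any vertex below (resp. above) a certain level. Then by insertion
> tolerance, there would also be a heavy cluster with a single lowest (resp. uppermost) vertex.
> Let every vertex of the cluster send unit mass to this vertex. This contradicts the MTP. □

Setting: `G` connected, locally finite, transitive (`IsGraphTransitive`, full automorphism group)
and nonunimodular; weights `w = autWeight G o`; Bernoulli(`p`) bond percolation `bondPercolation G p`
with `0 < p < 1` (both tolerances are used; at `p ∈ {0, 1}` the configuration is a.s. empty /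
everything); slabs `weightSlab G o a b = {a < w ≤ b}` with `a ≤ Δ b` (width `≥ 1` in Timár's
logarithmic scale, `Δ = minNbrWeight G o`, `TimarSlabs.lean`). We PROVE, in the order of the
printed proof read backwards:

* `ae_not_isTopOf`, `ae_not_isBotOf` — **"let every vertex of the cluster send unit mass to this
  vertex. This contradicts the MTP"**: almost surely no heavy cluster has a unique uppermost
  (resp. a unique lowest) vertex. The transport `x ↦ y` = `1[C(x) heavy, y its unique top]`
  (`topTransport`) is `Aut(G)`-diagonally invariant and measurable; each `x` sends mass `≤ 1`,
  while a unique top `y` of a heavy cluster receives weighted mass `Σ_{x ∈ C(y)} w(x)/w(y) = ∞`;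
  Timár's Lemma 2.2 in its random form (`lintegral_tsum_eq_inv_autWeight_mul`,
  `TimarNonunimodularLevels.lean`) under the invariance of `P_p` (`bondPercolation_map_relabel_iso`).
* `ae_exists_lt_autWeight`, `ae_exists_autWeight_lt` — **"by insertion tolerance, there would also
  be a heavy cluster with a single lowest (resp. uppermost) vertex"**: almost surely no heavy
  cluster is bounded in weight from above (resp. from below). If `C(v)` is heavy with
  `Δ w(z) < w(v)` on `C(v)`, the long-edge neighbour `u` of `v` of weight `Δ⁻¹ w(v)` lies outside
  `C(v)`; closing the edges at `u` (deletion tolerance) and opening `[v, u]` (insertion tolerance)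
  produces the heavy cluster `C(v) ∪ {u}` with unique top `u`, an event of probability `0`.
* `ae_infinite_inter_weightSlab` — **Lemma 5.2** itself, "otherwise, by deletion tolerance, with
  positive probability there would be a heavy cluster that does not have any vertex below (resp.
  above) a certain level": if `C(x) ∩ L = K` is finite, closing the edges at `K` leaves `C(x) ∖ K`
  covered by the clusters of the finitely many neighbours of `K`, one of which is heavy
  (`IsHeavy.exists_isHeavy_inter`), misses the slab, and hence — the slab separates
  (`lt_autWeight_of_walk_avoiding`, `autWeight_le_of_walk_avoiding`) — lies entirely above or
  entirely below it.

Also here, reused by the later bricks: measurability of `ξ ↦ W(C_{Φ ξ}(x))` and of heaviness of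
clusters for measurably varying configurations (`measurable_setWeight_openCluster_comp`,
`measurableSet_isHeavy_openCluster_comp`; the plain versions are in
`TimarHeavyClustersErgodic.lean`), the "closed set" principle `openCluster_subset_of_forall_mem` (a set containing `x` and closed under
open steps contains `C(x)`), and the elementary surgery lemmas for closing the edges at a finite
vertex set (`edgesAt`) and opening one edge at an isolated vertex.

## References

* Á. Timár, Ann. Probab. 34 (2006) 2344–2364 (arXiv:math/0702875), §5, Lemma 5.2 and its proof;
  Lemma 2.2 (MTP). [Timar2006]
* R. Lyons, Y. Peres, *Probability on Trees and Networks*, CUP 2016, §7.3 (insertion and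
  deletion tolerance), §8.2 ((8.10)). [LyonsPeres2016]
-/

noncomputable section

namespace Literature.Barriers.CriticalPhenomena

open _root_.MeasureTheory _root_.ProbabilityTheory _root_.Filter
  Literature.Probability.LatticeModels Literature.Probability.Percolation SimpleGraph
open scoped ENNReal

variable {V : Type*}

/-! ### Clusters: the closed-set principle and equality of clusters -/

/-- **A set containing `x` and closed under open steps contains the open cluster of `x`.**
[folklore] -/
theorem openCluster_subset_of_forall_mem {ω : BondConfig V} {x : V} {S : Set V} (hx : x ∈ S)
    (hS : ∀ a b, a ∈ S → s(a, b) ∈ ω → a ≠ b → b ∈ S) : openCluster ω x ⊆ S := by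
  rintro y ⟨p⟩
  induction p with
  | nil => exact hx
  | cons hadj _ ih =>
    rw [openGraph_adj] at hadj
    exact ih (hS _ _ hx hadj.1 hadj.2)

/-- Membership in clusters is symmetric. [folklore] -/
theorem mem_openCluster_comm {ω : BondConfig V} {x y : V} : y ∈ openCluster ω x ↔ x ∈ openCluster ω y :=
  SimpleGraph.reachable_comm

/-- If `ω ⊆ E(G)`, the open graph is a subgraph of `G`. [folklore] -/
theorem openGraph_le_of_subset_edgeSet {G : SimpleGraph V} {ω : BondConfig V} (hω : ω ⊆ G.edgeSet) :
    openGraph ω ≤ G := fun a b hab => by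
  rw [openGraph_adj] at hab
  exact hω hab.1

/-! ### Unique extremal vertices of a vertex set -/

/-- `y` is the **unique uppermost vertex** of `C`: `y ∈ C` and every other vertex of `C` has
strictly smaller weight ("a heavy cluster with a single … uppermost vertex", Timár 2006, proof of
Lemma 5.2). [cite: Timar2006, Lemma 5.2 (proof: single uppermost vertex)] -/
def IsTopOf (G : SimpleGraph V) (o : V) (C : Set V) (y : V) : Prop :=
  y ∈ C ∧ ∀ z ∈ C, z ≠ y → autWeight G o z < autWeight G o y

/-- `y` is the **unique lowest vertex** of `C` ("a single lowest vertex", ibid.).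
[cite: Timar2006, Lemma 5.2 (proof: single lowest vertex)] -/
def IsBotOf (G : SimpleGraph V) (o : V) (C : Set V) (y : V) : Prop :=
  y ∈ C ∧ ∀ z ∈ C, z ≠ y → autWeight G o y < autWeight G o z

/-- A set has at most one unique top. [folklore] -/
theorem IsTopOf.eq {G : SimpleGraph V} {o : V} {C : Set V} {y y' : V} (hy : IsTopOf G o C y)
    (hy' : IsTopOf G o C y') : y = y' := by
  by_contra hne
  exact lt_asymm (hy.2 y' hy'.1 (Ne.symm hne)) (hy'.2 y hy.1 hne)

/-- A set has at most one unique bottom. [folklore] -/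
theorem IsBotOf.eq {G : SimpleGraph V} {o : V} {C : Set V} {y y' : V} (hy : IsBotOf G o C y)
    (hy' : IsBotOf G o C y') : y = y' := by
  by_contra hne
  exact lt_asymm (hy.2 y' hy'.1 (Ne.symm hne)) (hy'.2 y hy.1 hne)

/-- Comparison of weights is invariant under automorphisms. [folklore] -/
theorem autWeight_map_lt_map_iff (G : SimpleGraph V) [G.LocallyFinite] (hconn : G.Connected)
    (γ : G ≃g G) (o u v : V) : autWeight G o (γ u) < autWeight G o (γ v) ↔ autWeight G o u < autWeight G o v := by
  rw [autWeight_map_eq_mul G hconn γ o u, autWeight_map_eq_mul G hconn γ o v,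
    ENNReal.mul_lt_mul_iff_right (autWeight_ne_zero G hconn o (γ o)) (autWeight_ne_top G hconn o (γ o))]

/-- Unique tops are transported by automorphisms. [folklore] -/
theorem isTopOf_image_iff (G : SimpleGraph V) [G.LocallyFinite] (hconn : G.Connected) (γ : G ≃g G)
    (o : V) (C : Set V) (y : V) : IsTopOf G o ((γ : V → V) '' C) (γ y) ↔ IsTopOf G o C y := by
  constructor
  · rintro ⟨hy, h⟩
    refine ⟨(γ.injective.mem_set_image).1 hy, fun z hz hne => ?_⟩
    rw [← autWeight_map_lt_map_iff G hconn γ o]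
    exact h (γ z) (Set.mem_image_of_mem _ hz) (fun h' => hne (γ.injective h'))
  · rintro ⟨hy, h⟩
    refine ⟨Set.mem_image_of_mem _ hy, ?_⟩
    rintro _ ⟨z, hz, rfl⟩ hne
    rw [autWeight_map_lt_map_iff G hconn γ o]
    exact h z hz (fun h' => hne (congrArg γ h'))

/-- Unique bottoms are transported by automorphisms. [folklore] -/
theorem isBotOf_image_iff (G : SimpleGraph V) [G.LocallyFinite] (hconn : G.Connected) (γ : G ≃g G)
    (o : V) (C : Set V) (y : V) : IsBotOf G o ((γ : V → V) '' C) (γ y) ↔ IsBotOf G o C y := by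
  constructor
  · rintro ⟨hy, h⟩
    refine ⟨(γ.injective.mem_set_image).1 hy, fun z hz hne => ?_⟩
    rw [← autWeight_map_lt_map_iff G hconn γ o]
    exact h (γ z) (Set.mem_image_of_mem _ hz) (fun h' => hne (γ.injective h'))
  · rintro ⟨hy, h⟩
    refine ⟨Set.mem_image_of_mem _ hy, ?_⟩
    rintro _ ⟨z, hz, rfl⟩ hne
    rw [autWeight_map_lt_map_iff G hconn γ o]
    exact h z hz (fun h' => hne (congrArg γ h'))

/-! ### Measurability of the weight of a cluster -/

section Measurability

variable [Countable V]

/-- **`ω ↦ W(C_{Φ ω}(x))` is measurable** for a measurably varying configuration `Φ`: a countable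
sum of the measurable `w(v) 1[x ↔ v]`. [folklore] -/
theorem measurable_setWeight_openCluster_comp {Ω : Type*} [MeasurableSpace Ω]
    {Φ : Ω → BondConfig V} (hΦ : Measurable Φ) (G : SimpleGraph V) (o x : V) :
    Measurable fun ξ => setWeight G o (openCluster (Φ ξ) x) := by
  classical
  have h : ∀ ξ, setWeight G o (openCluster (Φ ξ) x) =
      ∑' v, if (openGraph (Φ ξ)).Reachable x v then autWeight G o v else 0 := by
    intro ξ
    rw [setWeight]
    refine tsum_congr fun v => ?_
    by_cases hv : (openGraph (Φ ξ)).Reachable x v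
    · rw [Set.indicator_of_mem (show v ∈ openCluster (Φ ξ) x from hv), if_pos hv]
    · rw [Set.indicator_of_notMem (show v ∉ openCluster (Φ ξ) x from hv), if_neg hv]
  simp_rw [h]
  refine measurable_tsum_ennreal fun v => ?_
  exact Measurable.ite (measurableSet_reachable_comp hΦ x v) measurable_const measurable_const

/-- **The event "`C_{Φ ω}(x)` is heavy" is measurable.** [folklore] -/
theorem measurableSet_isHeavy_openCluster_comp {Ω : Type*} [MeasurableSpace Ω]
    {Φ : Ω → BondConfig V} (hΦ : Measurable Φ) (G : SimpleGraph V) (o x : V) :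
    MeasurableSet {ξ | IsHeavy G o (openCluster (Φ ξ) x)} :=
  (measurable_setWeight_openCluster_comp hΦ G o x) (measurableSet_singleton ⊤)

/-- The event "`y` is the unique top of `C_{Φ ω}(x)`" is measurable. [folklore] -/
theorem measurableSet_isTopOf_openCluster_comp {Ω : Type*} [MeasurableSpace Ω]
    {Φ : Ω → BondConfig V} (hΦ : Measurable Φ) (G : SimpleGraph V) (o x y : V) :
    MeasurableSet {ξ | IsTopOf G o (openCluster (Φ ξ) x) y} := by
  have hrepr : {ξ : Ω | IsTopOf G o (openCluster (Φ ξ) x) y} =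
      {ξ | (openGraph (Φ ξ)).Reachable x y} ∩
        ⋂ z, ({ξ | (openGraph (Φ ξ)).Reachable x z}ᶜ ∪ {_ξ | z ≠ y → autWeight G o z < autWeight G o y}) := by
    ext ξ
    simp only [IsTopOf, openCluster, Set.mem_setOf_eq, Set.mem_inter_iff, Set.mem_iInter,
      Set.mem_union, Set.mem_compl_iff]
    refine and_congr_right fun _ => forall_congr' fun z => ?_
    exact ⟨fun h => (em ((openGraph (Φ ξ)).Reachable x z)).elim (fun hr => Or.inr (h hr)) Or.inl,
      fun h hr => h.elim (fun hn => absurd hr hn) id⟩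
  rw [hrepr]
  refine (measurableSet_reachable_comp hΦ x y).inter (MeasurableSet.iInter fun z => ?_)
  exact (measurableSet_reachable_comp hΦ x z).compl.union (MeasurableSet.const _)

/-- The event "`y` is the unique bottom of `C_{Φ ω}(x)`" is measurable. [folklore] -/
theorem measurableSet_isBotOf_openCluster_comp {Ω : Type*} [MeasurableSpace Ω]
    {Φ : Ω → BondConfig V} (hΦ : Measurable Φ) (G : SimpleGraph V) (o x y : V) :
    MeasurableSet {ξ | IsBotOf G o (openCluster (Φ ξ) x) y} := by
  have hrepr : {ξ : Ω | IsBotOf G o (openCluster (Φ ξ) x) y} =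
      {ξ | (openGraph (Φ ξ)).Reachable x y} ∩
        ⋂ z, ({ξ | (openGraph (Φ ξ)).Reachable x z}ᶜ ∪ {_ξ | z ≠ y → autWeight G o y < autWeight G o z}) := by
    ext ξ
    simp only [IsBotOf, openCluster, Set.mem_setOf_eq, Set.mem_inter_iff, Set.mem_iInter,
      Set.mem_union, Set.mem_compl_iff]
    refine and_congr_right fun _ => forall_congr' fun z => ?_
    exact ⟨fun h => (em ((openGraph (Φ ξ)).Reachable x z)).elim (fun hr => Or.inr (h hr)) Or.inl,
      fun h hr => h.elim (fun hn => absurd hr hn) id⟩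
  rw [hrepr]
  refine (measurableSet_reachable_comp hΦ x y).inter (MeasurableSet.iInter fun z => ?_)
  exact (measurableSet_reachable_comp hΦ x z).compl.union (MeasurableSet.const _)

end Measurability

/-! ### "Let every vertex of the cluster send unit mass to this vertex": no unique extremal vertex -/

section NoExtremalVertex

variable {G : SimpleGraph V}

/-- The **unit-mass transport to the unique top**: `x` sends mass `1` to `y` when `C(x)` is heavy
and `y` is its unique uppermost vertex. [cite: Timar2006, Lemma 5.2 (proof: "send unit mass to this vertex")] -/
def topTransport (G : SimpleGraph V) (o : V) (ω : BondConfig V) (x y : V) : ℝ≥0∞ :=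
  {ω : BondConfig V | IsHeavy G o (openCluster ω x) ∧ IsTopOf G o (openCluster ω x) y}.indicator 1 ω

/-- The **unit-mass transport to the unique bottom**. [cite: Timar2006, Lemma 5.2 (proof: "send unit mass to this vertex")] -/
def botTransport (G : SimpleGraph V) (o : V) (ω : BondConfig V) (x y : V) : ℝ≥0∞ :=
  {ω : BondConfig V | IsHeavy G o (openCluster ω x) ∧ IsBotOf G o (openCluster ω x) y}.indicator 1 ω

/-- A `[0, ∞]`-valued function bounded by `1` and supported on at most one point has sum `≤ 1`.
[folklore] -/
theorem tsum_le_one_of_subsingleton_support {f : V → ℝ≥0∞} (hle : ∀ y, f y ≤ 1)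
    (hsub : ∀ y y', f y ≠ 0 → f y' ≠ 0 → y = y') : ∑' y, f y ≤ 1 := by
  by_cases h : ∃ y, f y ≠ 0
  · obtain ⟨y, hy⟩ := h
    rw [tsum_eq_single y fun y' hy' => ?_]
    · exact hle y
    · by_contra h0
      exact hy' (hsub y' y h0 hy)
  · push Not at h
    simp only [h, tsum_zero]
    exact zero_le_one

/-- Each vertex sends total mass at most `1` under `topTransport`. [cite: Timar2006, Lemma 5.2 (proof)] -/
theorem tsum_topTransport_le_one (o : V) (ω : BondConfig V) (x : V) :
    ∑' y, topTransport G o ω x y ≤ 1 := by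
  refine tsum_le_one_of_subsingleton_support (fun y => ?_) (fun y y' hy hy' => ?_)
  · unfold topTransport
    exact Set.indicator_le_self' (fun _ _ => zero_le_one) ω |>.trans le_rfl
  · unfold topTransport at hy hy'
    rw [Set.indicator_apply_ne_zero, Function.support_one, Set.inter_univ] at hy hy'
    exact hy.2.eq hy'.2

/-- Each vertex sends total mass at most `1` under `botTransport`. [cite: Timar2006, Lemma 5.2 (proof)] -/
theorem tsum_botTransport_le_one (o : V) (ω : BondConfig V) (x : V) :
    ∑' y, botTransport G o ω x y ≤ 1 := by
  refine tsum_le_one_of_subsingleton_support (fun y => ?_) (fun y y' hy hy' => ?_)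
  · unfold botTransport
    exact Set.indicator_le_self' (fun _ _ => zero_le_one) ω |>.trans le_rfl
  · unfold botTransport at hy hy'
    rw [Set.indicator_apply_ne_zero, Function.support_one, Set.inter_univ] at hy hy'
    exact hy.2.eq hy'.2

/-- **The unique top of a heavy cluster receives infinite weighted mass**: if `C(x)` is heavy
with unique top `x`, then `Σ_y topTransport(y, x) w(y) = Σ_{y ∈ C(x)} w(y) = ∞`.
[cite: Timar2006, Lemma 5.2 (proof: "This contradicts the MTP")] -/
theorem tsum_topTransport_mul_eq_top {o : V} {ω : BondConfig V} {x : V}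
    (hH : IsHeavy G o (openCluster ω x)) (hT : IsTopOf G o (openCluster ω x) x) :
    ∑' y, topTransport G o ω y x * autWeight G o y = ⊤ := by
  have h : ∀ y, topTransport G o ω y x * autWeight G o y = (openCluster ω x).indicator (autWeight G o) y := by
    intro y
    by_cases hy : y ∈ openCluster ω x
    · have hC : openCluster ω y = openCluster ω x := openCluster_eq_openCluster_of_mem hy
      rw [Set.indicator_of_mem hy, topTransport, Set.indicator_of_mem, Pi.one_apply, one_mul]
      exact ⟨hC ▸ hH, hC ▸ hT⟩
    · rw [Set.indicator_of_notMem hy, topTransport, Set.indicator_of_notMem, zero_mul]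
      rintro ⟨-, hT'⟩
      exact hy (mem_openCluster_comm.1 hT'.1)
  simp_rw [h]
  exact hH

/-- The unique bottom of a heavy cluster receives infinite weighted mass.
[cite: Timar2006, Lemma 5.2 (proof: "This contradicts the MTP")] -/
theorem tsum_botTransport_mul_eq_top {o : V} {ω : BondConfig V} {x : V}
    (hH : IsHeavy G o (openCluster ω x)) (hB : IsBotOf G o (openCluster ω x) x) :
    ∑' y, botTransport G o ω y x * autWeight G o y = ⊤ := by
  have h : ∀ y, botTransport G o ω y x * autWeight G o y = (openCluster ω x).indicator (autWeight G o) y := by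
    intro y
    by_cases hy : y ∈ openCluster ω x
    · have hC : openCluster ω y = openCluster ω x := openCluster_eq_openCluster_of_mem hy
      rw [Set.indicator_of_mem hy, botTransport, Set.indicator_of_mem, Pi.one_apply, one_mul]
      exact ⟨hC ▸ hH, hC ▸ hB⟩
    · rw [Set.indicator_of_notMem hy, botTransport, Set.indicator_of_notMem, zero_mul]
      rintro ⟨-, hB'⟩
      exact hy (mem_openCluster_comm.1 hB'.1)
  simp_rw [h]
  exact hH

/-- `topTransport` is diagonally invariant under automorphisms. [folklore] -/
theorem topTransport_relabel [G.LocallyFinite] (hconn : G.Connected) (γ : G ≃g G) (o : V)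
    (ω : BondConfig V) (x y : V) :
    topTransport G o (BondConfig.relabel (sym2Equiv γ.toEquiv) ω) (γ x) (γ y) = topTransport G o ω x y := by
  have hC : openCluster (BondConfig.relabel (sym2Equiv γ.toEquiv) ω) (γ x) = (γ : V → V) '' openCluster ω x :=
    openCluster_relabel γ.toEquiv ω x
  have key : (IsHeavy G o (openCluster (BondConfig.relabel (sym2Equiv γ.toEquiv) ω) (γ x)) ∧
      IsTopOf G o (openCluster (BondConfig.relabel (sym2Equiv γ.toEquiv) ω) (γ x)) (γ y)) ↔
      (IsHeavy G o (openCluster ω x) ∧ IsTopOf G o (openCluster ω x) y) := by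
    rw [hC, isHeavy_image_iff G hconn γ o, isTopOf_image_iff G hconn γ o]
  unfold topTransport
  classical
  simp only [Set.indicator_apply, Set.mem_setOf_eq, key, Pi.one_apply]

/-- `botTransport` is diagonally invariant under automorphisms. [folklore] -/
theorem botTransport_relabel [G.LocallyFinite] (hconn : G.Connected) (γ : G ≃g G) (o : V)
    (ω : BondConfig V) (x y : V) :
    botTransport G o (BondConfig.relabel (sym2Equiv γ.toEquiv) ω) (γ x) (γ y) = botTransport G o ω x y := by
  have hC : openCluster (BondConfig.relabel (sym2Equiv γ.toEquiv) ω) (γ x) = (γ : V → V) '' openCluster ω x :=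
    openCluster_relabel γ.toEquiv ω x
  have key : (IsHeavy G o (openCluster (BondConfig.relabel (sym2Equiv γ.toEquiv) ω) (γ x)) ∧
      IsBotOf G o (openCluster (BondConfig.relabel (sym2Equiv γ.toEquiv) ω) (γ x)) (γ y)) ↔
      (IsHeavy G o (openCluster ω x) ∧ IsBotOf G o (openCluster ω x) y) := by
    rw [hC, isHeavy_image_iff G hconn γ o, isBotOf_image_iff G hconn γ o]
  unfold botTransport
  classical
  simp only [Set.indicator_apply, Set.mem_setOf_eq, key, Pi.one_apply]

variable [Countable V]

/-- `topTransport` is measurable in the configuration. [folklore] -/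
theorem measurable_topTransport (o x y : V) : Measurable fun ω : BondConfig V => topTransport G o ω x y := by
  unfold topTransport
  exact measurable_one.indicator
    ((measurableSet_isHeavy_openCluster G o x).inter (measurableSet_isTopOf_openCluster_comp measurable_id G o x y))

/-- `botTransport` is measurable in the configuration. [folklore] -/
theorem measurable_botTransport (o x y : V) : Measurable fun ω : BondConfig V => botTransport G o ω x y := by
  unfold botTransport
  exact measurable_one.indicator
    ((measurableSet_isHeavy_openCluster G o x).inter (measurableSet_isBotOf_openCluster_comp measurable_id G o x y))

/-- **The MTP step of Lemma 5.2**: for every vertex `x`, the event "`C(x)` is heavy and `x` is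
its unique uppermost vertex" is null. The expected mass sent by `x` is `≤ 1`, the expected
weighted mass received is `∞ · P(event)`, and Lemma 2.2 equates them up to the factor `w(x)⁻¹`.
[cite: Timar2006, Lemma 5.2 (proof: MTP contradiction)] -/
theorem measure_isHeavy_and_isTopOf_eq_zero [G.LocallyFinite] (hconn : G.Connected) (ht : IsGraphTransitive G)
    (p : unitInterval) (o x : V) :
    bondPercolation G p {ω | IsHeavy G o (openCluster ω x) ∧ IsTopOf G o (openCluster ω x) x} = 0 := by
  set μ := bondPercolation G p with hμ
  set E := {ω : BondConfig V | IsHeavy G o (openCluster ω x) ∧ IsTopOf G o (openCluster ω x) x} with hE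
  have hEm : MeasurableSet E :=
    (measurableSet_isHeavy_openCluster G o x).inter (measurableSet_isTopOf_openCluster_comp measurable_id G o x x)
  by_contra hne
  -- the MTP for the top transport
  have hmtp := lintegral_tsum_eq_inv_autWeight_mul G hconn ht μ
    (fun γ => (BondConfig.relabel (sym2Equiv γ.toEquiv) : BondConfig V → BondConfig V))
    (fun γ => (BondConfig.relabel (sym2Equiv γ.toEquiv)).measurable)
    (fun γ => bondPercolation_map_relabel_iso γ p)
    (φ := fun x y ω => topTransport G o ω x y) (fun x y => measurable_topTransport o x y)
    (fun γ x y ω => topTransport_relabel hconn γ o ω x y) o x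
  -- left side `≤ 1`
  have hle : ∫⁻ ω, ∑' y, topTransport G o ω x y ∂μ ≤ 1 := by
    calc ∫⁻ ω, ∑' y, topTransport G o ω x y ∂μ ≤ ∫⁻ _, 1 ∂μ :=
          lintegral_mono fun ω => tsum_topTransport_le_one o ω x
      _ = 1 := by rw [lintegral_const, measure_univ, mul_one]
  -- right side `= ∞`
  have hge : ∫⁻ ω, ∑' y, topTransport G o ω y x * autWeight G o y ∂μ = ⊤ := by
    refine eq_top_iff.2 ?_
    calc (⊤ : ℝ≥0∞) = ⊤ * μ E := by rw [ENNReal.top_mul hne]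
      _ = ∫⁻ ω, E.indicator (fun _ => (⊤ : ℝ≥0∞)) ω ∂μ := by rw [lintegral_indicator_const hEm]
      _ ≤ ∫⁻ ω, ∑' y, topTransport G o ω y x * autWeight G o y ∂μ := by
          refine lintegral_mono fun ω => ?_
          by_cases hω : ω ∈ E
          · rw [Set.indicator_of_mem hω, tsum_topTransport_mul_eq_top hω.1 hω.2]
          · rw [Set.indicator_of_notMem hω]
            exact bot_le
  rw [hge, ENNReal.mul_top (ENNReal.inv_ne_zero.2 (autWeight_ne_top G hconn o x))] at hmtp
  exact absurd (hmtp ▸ hle) (not_le.2 ENNReal.one_lt_top)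

/-- The bottom version: "`C(x)` is heavy and `x` is its unique lowest vertex" is null.
[cite: Timar2006, Lemma 5.2 (proof: MTP contradiction)] -/
theorem measure_isHeavy_and_isBotOf_eq_zero [G.LocallyFinite] (hconn : G.Connected) (ht : IsGraphTransitive G)
    (p : unitInterval) (o x : V) :
    bondPercolation G p {ω | IsHeavy G o (openCluster ω x) ∧ IsBotOf G o (openCluster ω x) x} = 0 := by
  set μ := bondPercolation G p with hμ
  set E := {ω : BondConfig V | IsHeavy G o (openCluster ω x) ∧ IsBotOf G o (openCluster ω x) x} with hE
  have hEm : MeasurableSet E :=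
    (measurableSet_isHeavy_openCluster G o x).inter (measurableSet_isBotOf_openCluster_comp measurable_id G o x x)
  by_contra hne
  have hmtp := lintegral_tsum_eq_inv_autWeight_mul G hconn ht μ
    (fun γ => (BondConfig.relabel (sym2Equiv γ.toEquiv) : BondConfig V → BondConfig V))
    (fun γ => (BondConfig.relabel (sym2Equiv γ.toEquiv)).measurable)
    (fun γ => bondPercolation_map_relabel_iso γ p)
    (φ := fun x y ω => botTransport G o ω x y) (fun x y => measurable_botTransport o x y)
    (fun γ x y ω => botTransport_relabel hconn γ o ω x y) o x
  have hle : ∫⁻ ω, ∑' y, botTransport G o ω x y ∂μ ≤ 1 := by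
    calc ∫⁻ ω, ∑' y, botTransport G o ω x y ∂μ ≤ ∫⁻ _, 1 ∂μ :=
          lintegral_mono fun ω => tsum_botTransport_le_one o ω x
      _ = 1 := by rw [lintegral_const, measure_univ, mul_one]
  have hge : ∫⁻ ω, ∑' y, botTransport G o ω y x * autWeight G o y ∂μ = ⊤ := by
    refine eq_top_iff.2 ?_
    calc (⊤ : ℝ≥0∞) = ⊤ * μ E := by rw [ENNReal.top_mul hne]
      _ = ∫⁻ ω, E.indicator (fun _ => (⊤ : ℝ≥0∞)) ω ∂μ := by rw [lintegral_indicator_const hEm]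
      _ ≤ ∫⁻ ω, ∑' y, botTransport G o ω y x * autWeight G o y ∂μ := by
          refine lintegral_mono fun ω => ?_
          by_cases hω : ω ∈ E
          · rw [Set.indicator_of_mem hω, tsum_botTransport_mul_eq_top hω.1 hω.2]
          · rw [Set.indicator_of_notMem hω]
            exact bot_le
  rw [hge, ENNReal.mul_top (ENNReal.inv_ne_zero.2 (autWeight_ne_top G hconn o x))] at hmtp
  exact absurd (hmtp ▸ hle) (not_le.2 ENNReal.one_lt_top)

/-- **Almost surely no heavy cluster has a unique uppermost vertex** (any `p`).
[cite: Timar2006, Lemma 5.2 (proof: MTP contradiction)] -/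
theorem ae_not_isTopOf [G.LocallyFinite] (hconn : G.Connected) (ht : IsGraphTransitive G) (p : unitInterval) (o : V) :
    ∀ᵐ ω ∂(bondPercolation G p), ∀ x y, IsHeavy G o (openCluster ω x) → ¬ IsTopOf G o (openCluster ω x) y := by
  have h : ∀ y, ∀ᵐ ω ∂(bondPercolation G p),
      ¬ (IsHeavy G o (openCluster ω y) ∧ IsTopOf G o (openCluster ω y) y) := fun y =>
    measure_eq_zero_iff_ae_notMem.1 (measure_isHeavy_and_isTopOf_eq_zero hconn ht p o y)
  rw [← ae_all_iff] at h
  filter_upwards [h] with ω hω x y hH hT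
  have hC : openCluster ω y = openCluster ω x := openCluster_eq_openCluster_of_mem hT.1
  exact hω y ⟨hC ▸ hH, hC ▸ hT⟩

/-- **Almost surely no heavy cluster has a unique lowest vertex** (any `p`).
[cite: Timar2006, Lemma 5.2 (proof: MTP contradiction)] -/
theorem ae_not_isBotOf [G.LocallyFinite] (hconn : G.Connected) (ht : IsGraphTransitive G) (p : unitInterval) (o : V) :
    ∀ᵐ ω ∂(bondPercolation G p), ∀ x y, IsHeavy G o (openCluster ω x) → ¬ IsBotOf G o (openCluster ω x) y := by
  have h : ∀ y, ∀ᵐ ω ∂(bondPercolation G p),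
      ¬ (IsHeavy G o (openCluster ω y) ∧ IsBotOf G o (openCluster ω y) y) := fun y =>
    measure_eq_zero_iff_ae_notMem.1 (measure_isHeavy_and_isBotOf_eq_zero hconn ht p o y)
  rw [← ae_all_iff] at h
  filter_upwards [h] with ω hω x y hH hB
  have hC : openCluster ω y = openCluster ω x := openCluster_eq_openCluster_of_mem hB.1
  exact hω y ⟨hC ▸ hH, hC ▸ hB⟩

end NoExtremalVertex

/-! ### The closed-set principle along reachability; edges at a finite vertex set -/

/-- **Closed-set principle, cluster form**: a set containing `x` and closed under open steps out
of vertices of `C(x)` contains `C(x)`. [folklore] -/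
theorem openCluster_subset_of_forall_mem' {ω : BondConfig V} {x : V} {S : Set V} (hx : x ∈ S)
    (hS : ∀ a b, a ∈ openCluster ω x → a ∈ S → s(a, b) ∈ ω → a ≠ b → b ∈ S) :
    openCluster ω x ⊆ S := by
  intro y hy
  change (openGraph ω).Reachable x y at hy
  rw [SimpleGraph.reachable_iff_reflTransGen] at hy
  induction hy with
  | refl => exact hx
  | tail hab hbc ih =>
    rw [openGraph_adj] at hbc
    exact hS _ _ ((SimpleGraph.reachable_iff_reflTransGen _ _).2 hab) ih hbc.1 hbc.2

section EdgesAt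

variable [DecidableEq V] (G : SimpleGraph V) [G.LocallyFinite]

/-- The (finite) set of edges of `G` with an endpoint in the finite vertex set `K`. [folklore] -/
def edgesAt (K : Finset V) : Finset (Sym2 V) :=
  K.biUnion fun k => G.incidenceFinset k

variable {G}

/-- Membership in `edgesAt`. [folklore] -/
theorem mem_edgesAt {K : Finset V} {e : Sym2 V} :
    e ∈ edgesAt G K ↔ e ∈ G.edgeSet ∧ ∃ k ∈ K, k ∈ e := by
  simp only [edgesAt, Finset.mem_biUnion, SimpleGraph.mem_incidenceFinset, SimpleGraph.incidenceSet,
    Set.mem_setOf_eq]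
  exact ⟨fun ⟨k, hk, he, hke⟩ => ⟨he, k, hk, hke⟩, fun ⟨he, k, hk, hke⟩ => ⟨k, hk, he, hke⟩⟩

/-- `edgesAt G K ⊆ E(G)`. [folklore] -/
theorem coe_edgesAt_subset (K : Finset V) : (↑(edgesAt G K) : Set (Sym2 V)) ⊆ G.edgeSet :=
  fun _ he => (mem_edgesAt.1 he).1

/-- After closing the edges at `K` (in a configuration `ω ⊆ E(G)`), no open edge has an endpoint
in `K`. [folklore] -/
theorem not_mem_closeEdges_edgesAt {K : Finset V} {ω : BondConfig V} (hω : ω ⊆ G.edgeSet)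
    {k b : V} (hk : k ∈ K) : s(k, b) ∉ closeEdges ↑(edgesAt G K) ω := by
  rw [mem_closeEdges, Finset.mem_coe, mem_edgesAt]
  rintro ⟨hmem, hnot⟩
  exact hnot ⟨hω hmem, k, hk, Sym2.mem_mk_left k b⟩

/-- After closing the edges at `K`, the cluster of a vertex of `K` is a singleton.
[folklore] -/
theorem openCluster_closeEdges_edgesAt_of_mem {K : Finset V} {ω : BondConfig V} (hω : ω ⊆ G.edgeSet)
    {k : V} (hk : k ∈ K) : openCluster (closeEdges ↑(edgesAt G K) ω) k = {k} := by
  refine Set.Subset.antisymm ?_ (by simp)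
  refine openCluster_subset_of_forall_mem' rfl fun a b _ ha hab _ => ?_
  rw [Set.mem_singleton_iff] at ha
  subst ha
  exact absurd hab (not_mem_closeEdges_edgesAt hω hk)

/-- An open edge with no endpoint in `K` stays open after closing the edges at `K`. [folklore] -/
theorem mk_mem_closeEdges_edgesAt {K : Finset V} {ω : BondConfig V} {a b : V} (hab : s(a, b) ∈ ω)
    (ha : a ∉ K) (hb : b ∉ K) : s(a, b) ∈ closeEdges ↑(edgesAt G K) ω := by
  rw [mem_closeEdges, Finset.mem_coe, mem_edgesAt]
  refine ⟨hab, ?_⟩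
  rintro ⟨-, k, hk, hke⟩
  rcases Sym2.mem_iff.1 hke with rfl | rfl
  · exact ha hk
  · exact hb hk

/-- **Closing the edges at `K` splits `C(x)` into `K` and the clusters of the neighbours of `K`
(and of `x`)**: `C_ω(x) ⊆ K ∪ ⋃_{z ∈ {x} ∪ N(K)} C_{ω - K}(z)` for `ω ⊆ E(G)`. [folklore] -/
theorem openCluster_subset_closeEdges_edgesAt {K : Finset V} {ω : BondConfig V} (hω : ω ⊆ G.edgeSet)
    (x : V) :
    openCluster ω x ⊆ ↑K ∪ ⋃ z ∈ insert x (K.biUnion fun k => G.neighborFinset k),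
      openCluster (closeEdges ↑(edgesAt G K) ω) z := by
  set ω' := closeEdges ↑(edgesAt G K) ω with hω'
  set N : Finset V := insert x (K.biUnion fun k => G.neighborFinset k) with hN
  refine openCluster_subset_of_forall_mem' ?_ fun a c _ ha hac hne => ?_
  · exact Or.inr (Set.mem_biUnion (Finset.mem_insert_self x _) (mem_openCluster_self ω' x))
  by_cases hcK : c ∈ K
  · exact Or.inl hcK
  by_cases haK : a ∈ K
  · -- `c` is a neighbour of `a ∈ K`, hence a centre
    have hadj : G.Adj a c := by
      have := hω hac
      rwa [SimpleGraph.mem_edgeSet] at this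
    have hcN : c ∈ N :=
      Finset.mem_insert_of_mem (Finset.mem_biUnion.2 ⟨a, haK, (G.mem_neighborFinset a c).2 hadj⟩)
    exact Or.inr (Set.mem_biUnion hcN (mem_openCluster_self ω' c))
  · rcases ha with haK' | ha
    · exact absurd haK' haK
    · obtain ⟨z, hz, haz⟩ := Set.mem_iUnion₂.1 ha
      exact Or.inr (Set.mem_biUnion hz
        (mem_openCluster_of_adj haz (mk_mem_closeEdges_edgesAt hac haK hcK) hne))

/-- If, after closing the edges at `K`, the cluster of `z` is heavy and meets `C_ω(x)` heavily…
more precisely: if `C_ω(x) ∩ C_{ω-K}(z)` is heavy then `z ∉ K`, `C_{ω-K}(z)` is heavy, misses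
`K`, and lies inside `C_ω(x)`. [folklore] -/
theorem closeEdges_edgesAt_piece {K : Finset V} {ω : BondConfig V} (hconn : G.Connected)
    (hω : ω ⊆ G.edgeSet) {o x z : V}
    (h : IsHeavy G o (openCluster ω x ∩ openCluster (closeEdges ↑(edgesAt G K) ω) z)) :
    z ∉ K ∧ IsHeavy G o (openCluster (closeEdges ↑(edgesAt G K) ω) z) ∧
      Disjoint (openCluster (closeEdges ↑(edgesAt G K) ω) z) ↑K ∧
      openCluster (closeEdges ↑(edgesAt G K) ω) z ⊆ openCluster ω x := by
  set ω' := closeEdges ↑(edgesAt G K) ω with hω'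
  have hzK : z ∉ K := by
    intro hz
    rw [openCluster_closeEdges_edgesAt_of_mem hω hz] at h
    exact not_isHeavy_of_finite G hconn o ((Set.finite_singleton z).subset Set.inter_subset_right) h
  have hdisj : Disjoint (openCluster ω' z) ↑K := by
    rw [Set.disjoint_left]
    intro k hk hkK
    have : z ∈ openCluster ω' k := mem_openCluster_comm.1 hk
    rw [openCluster_closeEdges_edgesAt_of_mem hω hkK, Set.mem_singleton_iff] at this
    exact hzK (this ▸ hkK)
  have hsub : openCluster ω' z ⊆ openCluster ω x := by
    obtain ⟨y, hyx, hyz⟩ := (IsHeavy.infinite hconn h).nonempty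
    have hzx : z ∈ openCluster ω x := by
      have hzy : z ∈ openCluster ω y := openCluster_mono (closeEdges_subset _ ω) y (mem_openCluster_comm.1 hyz)
      rwa [openCluster_eq_openCluster_of_mem hyx] at hzy
    rw [← openCluster_eq_openCluster_of_mem hzx]
    exact openCluster_mono (closeEdges_subset _ ω) z
  exact ⟨hzK, h.mono Set.inter_subset_right, hdisj, hsub⟩

/-- **Surgery at one vertex**: in `ω ⊆ E(G)` let `u ∉ C(v)` be a neighbour of `v` in `G`.
Closing the edges at `u` and then opening `[v, u]` gives `u` the cluster `C_ω(v) ∪ {u}`.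
[cite: Timar2006, Lemma 5.2 (proof: insertion tolerance step)] -/
theorem openCluster_openEdges_closeEdges_singleton {ω : BondConfig V} (hω : ω ⊆ G.edgeSet)
    {v u : V} (hvu : G.Adj v u) (hu : u ∉ openCluster ω v) :
    openCluster (openEdges {s(v, u)} (closeEdges ↑(edgesAt G {u}) ω)) u = insert u (openCluster ω v) := by
  set ω₁ := closeEdges ↑(edgesAt G {u}) ω with hω₁
  set ω₂ := openEdges {s(v, u)} ω₁ with hω₂
  -- closing the edges at `u` does not change `C(v)`
  have h1 : openCluster ω₁ v = openCluster ω v := by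
    refine Set.Subset.antisymm (openCluster_mono (closeEdges_subset _ ω) v) ?_
    refine openCluster_subset_of_forall_mem' (mem_openCluster_self ω₁ v) fun a b ha hab' hab hne => ?_
    refine mem_openCluster_of_adj hab' (mk_mem_closeEdges_edgesAt hab ?_ ?_) hne
    · rintro haU
      rw [Finset.mem_singleton] at haU
      exact hu (haU ▸ ha)
    · rintro hbU
      rw [Finset.mem_singleton] at hbU
      subst hbU
      exact hu (mem_openCluster_of_adj ha hab hne)
  refine Set.Subset.antisymm ?_ ?_
  · refine openCluster_subset_of_forall_mem' (Set.mem_insert u _) fun a b _ ha hab hne => ?_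
    rw [hω₂, mem_openEdges] at hab
    rcases hab with hab | hab
    · -- an edge of `ω₁`: not at `u`
      rcases ha with rfl | ha
      · exact absurd hab (not_mem_closeEdges_edgesAt hω (Finset.mem_singleton_self a))
      · rw [← h1]
        exact Or.inr (mem_openCluster_of_adj (h1.symm ▸ ha) hab hne)
    · -- the edge `[v, u]`
      rw [Set.mem_singleton_iff, Sym2.eq_iff] at hab
      rcases hab with ⟨rfl, rfl⟩ | ⟨rfl, rfl⟩
      · exact Set.mem_insert b _
      · exact Or.inr (mem_openCluster_self ω b)
  · -- `u` and `C_ω(v) = C_{ω₁}(v) ⊆ C_{ω₂}(v) = C_{ω₂}(u)`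
    have huv : v ∈ openCluster ω₂ u := by
      refine Adj.reachable ((openGraph_adj ω₂ u v).2 ⟨?_, hvu.ne.symm⟩)
      rw [hω₂, mem_openEdges, Sym2.eq_swap]
      exact Or.inr rfl
    rintro y (rfl | hy)
    · exact mem_openCluster_self ω₂ y
    · rw [← openCluster_eq_openCluster_of_mem huv, ← h1] at *
      exact openCluster_mono (subset_openEdges _ ω₁) v (h1.symm ▸ hy)

end EdgesAt

/-! ### "By insertion tolerance": no heavy cluster is bounded in weight -/

section Unbounded

variable [Countable V] {G : SimpleGraph V} [G.LocallyFinite]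

omit [G.LocallyFinite] in
/-- Events of the form "`C(x)` is heavy and every vertex of `C(x)` satisfies `P`" are measurable
(`P` any fixed predicate on vertices). [folklore] -/
theorem measurableSet_isHeavy_and_forall_mem (o x : V) (P : V → Prop) :
    MeasurableSet {ω : BondConfig V | IsHeavy G o (openCluster ω x) ∧ ∀ z ∈ openCluster ω x, P z} := by
  have hrepr : {ω : BondConfig V | IsHeavy G o (openCluster ω x) ∧ ∀ z ∈ openCluster ω x, P z} =
      {ω | IsHeavy G o (openCluster ω x)} ∩ ⋂ z, ({ω | (openGraph ω).Reachable x z}ᶜ ∪ {_ω | P z}) := by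
    ext ω
    simp only [openCluster, Set.mem_setOf_eq, Set.mem_inter_iff, Set.mem_iInter, Set.mem_union,
      Set.mem_compl_iff]
    refine and_congr_right fun _ => forall_congr' fun z => ?_
    exact ⟨fun h => (em ((openGraph ω).Reachable x z)).elim (fun hr => Or.inr (h hr)) Or.inl,
      fun h hr => h.elim (fun hn => absurd hr hn) id⟩
  rw [hrepr]
  refine (measurableSet_isHeavy_openCluster G o x).inter (MeasurableSet.iInter fun z => ?_)
  exact (measurableSet_openConn_holds x z).compl.union (MeasurableSet.const _)

omit [Countable V] in
/-- A positive-measure event has positive measure inside any almost sure event. [folklore] -/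
theorem measure_inter_ne_zero_of_ae {μ : Measure (BondConfig V)} {A E : Set (BondConfig V)}
    (hA : μ A ≠ 0) (hE : ∀ᵐ ω ∂μ, ω ∈ E) : μ (A ∩ E) ≠ 0 := by
  intro h0
  have hc : μ (A \ E) = 0 := measure_mono_null (fun ω hω => hω.2) (ae_iff.1 hE)
  have : μ A ≤ μ (A ∩ E) + μ (A \ E) :=
    (measure_mono fun ω hω => (em (ω ∈ E)).elim (fun h => Or.inl ⟨hω, h⟩) fun h => Or.inr ⟨hω, h⟩).trans
      (measure_union_le _ _)
  rw [h0, hc, zero_add, nonpos_iff_eq_zero] at this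
  exact hA this

/-- **"By insertion tolerance, there would also be a heavy cluster with a single uppermost
vertex"** — hence, by the MTP step, for `0 < p < 1` and every vertex `v`: almost surely, if
`C(v)` is heavy then NOT every vertex `z` of `C(v)` has `Δ w(z) < w(v)` (i.e. `C(v)` reaches
weights `≥ Δ⁻¹ w(v)`). Surgery: the long-edge neighbour `u` of `v` above `v` (`Δ w(u) = w(v)`)
lies outside `C(v)`; close the edges at `u` (deletion tolerance), open `[v, u]` (insertion
tolerance): `u` becomes the unique top of the heavy cluster `C(v) ∪ {u}`.
[cite: Timar2006, Lemma 5.2 (proof: deletion and insertion tolerance)] -/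
theorem ae_not_forall_mul_autWeight_lt (hconn : G.Connected) (ht : IsGraphTransitive G)
    (hU : ¬ IsGraphUnimodular G) {p : unitInterval} (hp0 : 0 < (p : ℝ)) (hp1 : (p : ℝ) < 1) (o : V) :
    ∀ᵐ ω ∂(bondPercolation G p), ∀ v, IsHeavy G o (openCluster ω v) →
      ¬ ∀ z ∈ openCluster ω v, minNbrWeight G o * autWeight G o z < autWeight G o v := by
  classical
  set μ := bondPercolation G p with hμ
  rw [ae_all_iff]
  intro v
  set A := {ω : BondConfig V | IsHeavy G o (openCluster ω v) ∧
    ∀ z ∈ openCluster ω v, minNbrWeight G o * autWeight G o z < autWeight G o v} with hA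
  suffices hA0 : μ A = 0 by
    filter_upwards [measure_eq_zero_iff_ae_notMem.1 hA0] with ω hω hH hall using hω ⟨hH, hall⟩
  by_contra hne
  -- the long edge up from `v`
  obtain ⟨u, hvu, hu⟩ := exists_adj_mul_autWeight_eq hconn ht hU o v
  set F : Finset (Sym2 V) := edgesAt G {u} with hF
  set T := {ω : BondConfig V | IsHeavy G o (openCluster ω u) ∧ IsTopOf G o (openCluster ω u) u} with hT
  have hTm : MeasurableSet T :=
    (measurableSet_isHeavy_openCluster G o u).inter (measurableSet_isTopOf_openCluster_comp measurable_id G o u u)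
  set E₁ : Set (BondConfig V) := openEdges {s(v, u)} ⁻¹' T with hE₁
  have hE₁m : MeasurableSet E₁ := measurable_openEdges _ hTm
  -- on `A ∩ {ω ⊆ E(G)}` the surgery lands in `T`
  have hsurg : ∀ ω ∈ A ∩ {ω | ω ⊆ G.edgeSet}, closeEdges ↑F ω ∈ E₁ := by
    rintro ω ⟨⟨hH, hall⟩, hωE⟩
    have hΔ0 := minNbrWeight_ne_zero hconn o
    have hΔT := minNbrWeight_ne_top hconn ht hU o
    have hlt : ∀ z ∈ openCluster ω v, autWeight G o z < autWeight G o u := by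
      intro z hz
      rw [← ENNReal.mul_lt_mul_iff_right hΔ0 hΔT, hu]
      exact hall z hz
    have huC : u ∉ openCluster ω v := fun h => lt_irrefl _ (hlt u h)
    change openEdges {s(v, u)} (closeEdges ↑F ω) ∈ T
    rw [hT, Set.mem_setOf_eq, hF, openCluster_openEdges_closeEdges_singleton hωE hvu huC]
    refine ⟨hH.mono (Set.subset_insert u _), Set.mem_insert u _, ?_⟩
    rintro z (rfl | hz) hne'
    · exact absurd rfl hne'
    · exact hlt z hz
  -- deletion tolerance, then insertion tolerance
  have hpos₀ : 0 < μ.real (A ∩ {ω | ω ⊆ G.edgeSet}) :=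
    ENNReal.toReal_pos (measure_inter_ne_zero_of_ae hne setBernoulli_ae_subset) (measure_ne_top _ _)
  have hpos₁ : 0 < μ.real E₁ :=
    bondPercolation_real_pos_of_closeEdges G hp1 F hE₁m hpos₀ hsurg
  have hsub : (↑({s(v, u)} : Finset (Sym2 V)) : Set (Sym2 V)) ⊆ G.edgeSet := by
    rw [Finset.coe_singleton, Set.singleton_subset_iff]
    exact hvu
  have hpos₂ : 0 < μ.real T := by
    refine bondPercolation_real_pos_of_openEdges G hp0 {s(v, u)} hsub hTm hpos₁ fun ω hω => ?_
    rwa [Finset.coe_singleton]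
  have hT0 : μ T = 0 := measure_isHeavy_and_isTopOf_eq_zero hconn ht p o u
  rw [measureReal_def, hT0, ENNReal.toReal_zero] at hpos₂
  exact lt_irrefl _ hpos₂

/-- **The lower version**: for `0 < p < 1` and every `v`, almost surely, if `C(v)` is heavy then
NOT every vertex `z` of `C(v)` has `Δ w(v) < w(z)`. (Surgery with the long-edge neighbour `u`
below `v`, `w(u) = Δ w(v)`, which becomes the unique bottom.)
[cite: Timar2006, Lemma 5.2 (proof: deletion and insertion tolerance)] -/
theorem ae_not_forall_mul_autWeight_lt' (hconn : G.Connected) (ht : IsGraphTransitive G)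
    (hU : ¬ IsGraphUnimodular G) {p : unitInterval} (hp0 : 0 < (p : ℝ)) (hp1 : (p : ℝ) < 1) (o : V) :
    ∀ᵐ ω ∂(bondPercolation G p), ∀ v, IsHeavy G o (openCluster ω v) →
      ¬ ∀ z ∈ openCluster ω v, minNbrWeight G o * autWeight G o v < autWeight G o z := by
  classical
  set μ := bondPercolation G p with hμ
  rw [ae_all_iff]
  intro v
  set A := {ω : BondConfig V | IsHeavy G o (openCluster ω v) ∧
    ∀ z ∈ openCluster ω v, minNbrWeight G o * autWeight G o v < autWeight G o z} with hA
  suffices hA0 : μ A = 0 by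
    filter_upwards [measure_eq_zero_iff_ae_notMem.1 hA0] with ω hω hH hall using hω ⟨hH, hall⟩
  by_contra hne
  -- the long edge down from `v`
  obtain ⟨u, hvu, hu⟩ := exists_adj_autWeight_eq_mul hconn ht hU o v
  set F : Finset (Sym2 V) := edgesAt G {u} with hF
  set T := {ω : BondConfig V | IsHeavy G o (openCluster ω u) ∧ IsBotOf G o (openCluster ω u) u} with hT
  have hTm : MeasurableSet T :=
    (measurableSet_isHeavy_openCluster G o u).inter (measurableSet_isBotOf_openCluster_comp measurable_id G o u u)
  set E₁ : Set (BondConfig V) := openEdges {s(v, u)} ⁻¹' T with hE₁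
  have hE₁m : MeasurableSet E₁ := measurable_openEdges _ hTm
  have hsurg : ∀ ω ∈ A ∩ {ω | ω ⊆ G.edgeSet}, closeEdges ↑F ω ∈ E₁ := by
    rintro ω ⟨⟨hH, hall⟩, hωE⟩
    have hlt : ∀ z ∈ openCluster ω v, autWeight G o u < autWeight G o z := by
      intro z hz
      rw [hu]
      exact hall z hz
    have huC : u ∉ openCluster ω v := fun h => lt_irrefl _ (hlt u h)
    change openEdges {s(v, u)} (closeEdges ↑F ω) ∈ T
    rw [hT, Set.mem_setOf_eq, hF, openCluster_openEdges_closeEdges_singleton hωE hvu huC]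
    refine ⟨hH.mono (Set.subset_insert u _), Set.mem_insert u _, ?_⟩
    rintro z (rfl | hz) hne'
    · exact absurd rfl hne'
    · exact hlt z hz
  have hpos₀ : 0 < μ.real (A ∩ {ω | ω ⊆ G.edgeSet}) :=
    ENNReal.toReal_pos (measure_inter_ne_zero_of_ae hne setBernoulli_ae_subset) (measure_ne_top _ _)
  have hpos₁ : 0 < μ.real E₁ :=
    bondPercolation_real_pos_of_closeEdges G hp1 F hE₁m hpos₀ hsurg
  have hsub : (↑({s(v, u)} : Finset (Sym2 V)) : Set (Sym2 V)) ⊆ G.edgeSet := by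
    rw [Finset.coe_singleton, Set.singleton_subset_iff]
    exact hvu
  have hpos₂ : 0 < μ.real T := by
    refine bondPercolation_real_pos_of_openEdges G hp0 {s(v, u)} hsub hTm hpos₁ fun ω hω => ?_
    rwa [Finset.coe_singleton]
  have hT0 : μ T = 0 := measure_isHeavy_and_isBotOf_eq_zero hconn ht p o u
  rw [measureReal_def, hT0, ENNReal.toReal_zero] at hpos₂
  exact lt_irrefl _ hpos₂

/-- **Almost surely no heavy cluster is bounded in weight from above**: for `0 < p < 1`, a.s.
every heavy cluster contains vertices of weight exceeding any finite bound ("there would be a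
heavy cluster that does not have any vertex above a certain level" is a null event).
[cite: Timar2006, Lemma 5.2 (proof)] -/
theorem ae_exists_lt_autWeight (hconn : G.Connected) (ht : IsGraphTransitive G)
    (hU : ¬ IsGraphUnimodular G) {p : unitInterval} (hp0 : 0 < (p : ℝ)) (hp1 : (p : ℝ) < 1) (o : V) :
    ∀ᵐ ω ∂(bondPercolation G p), ∀ x, IsHeavy G o (openCluster ω x) →
      ∀ t : ℝ≥0∞, t ≠ ⊤ → ∃ z ∈ openCluster ω x, t < autWeight G o z := by
  filter_upwards [ae_not_forall_mul_autWeight_lt hconn ht hU hp0 hp1 o] with ω hω x hH t htT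
  by_contra hno
  push Not at hno
  -- `s = sup_{C(x)} w ∈ (0, ∞)`, and `Δ s < s` is exceeded by some `w(v)`, `v ∈ C(x)`
  set s : ℝ≥0∞ := ⨆ z ∈ openCluster ω x, autWeight G o z with hs
  have hsT : s ≠ ⊤ := ne_top_of_le_ne_top htT (iSup₂_le hno)
  have hs0 : s ≠ 0 := by
    refine fun h0 => autWeight_ne_zero G hconn o x (le_antisymm ?_ bot_le)
    exact h0 ▸ le_iSup₂ (f := fun z (_ : z ∈ openCluster ω x) => autWeight G o z) x (mem_openCluster_self ω x)
  have hlt : minNbrWeight G o * s < s := by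
    calc minNbrWeight G o * s < 1 * s :=
          ENNReal.mul_lt_mul_left hs0 hsT (minNbrWeight_lt_one hconn ht hU o)
      _ = s := one_mul s
  rw [hs, lt_biSup_iff] at hlt
  obtain ⟨v, hv, hvlt⟩ := hlt
  have hC : openCluster ω v = openCluster ω x := openCluster_eq_openCluster_of_mem hv
  refine hω v (hC ▸ hH) fun z hz => ?_
  rw [hC] at hz
  calc minNbrWeight G o * autWeight G o z ≤ minNbrWeight G o * s := by
        gcongr; exact le_iSup₂ (f := fun z (_ : z ∈ openCluster ω x) => autWeight G o z) z hz
    _ < autWeight G o v := hvlt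

/-- **Almost surely no heavy cluster is bounded in weight from below**: for `0 < p < 1`, a.s.
every heavy cluster contains vertices of weight below any positive bound ("… does not have any
vertex below a certain level" is a null event). [cite: Timar2006, Lemma 5.2 (proof)] -/
theorem ae_exists_autWeight_lt (hconn : G.Connected) (ht : IsGraphTransitive G)
    (hU : ¬ IsGraphUnimodular G) {p : unitInterval} (hp0 : 0 < (p : ℝ)) (hp1 : (p : ℝ) < 1) (o : V) :
    ∀ᵐ ω ∂(bondPercolation G p), ∀ x, IsHeavy G o (openCluster ω x) →
      ∀ t : ℝ≥0∞, t ≠ 0 → ∃ z ∈ openCluster ω x, autWeight G o z < t := by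
  filter_upwards [ae_not_forall_mul_autWeight_lt' hconn ht hU hp0 hp1 o] with ω hω x hH t ht0
  by_contra hno
  push Not at hno
  -- `i = inf_{C(x)} w ∈ (0, ∞)`, and some `w(v)`, `v ∈ C(x)`, is below `i / Δ`
  set i : ℝ≥0∞ := ⨅ z ∈ openCluster ω x, autWeight G o z with hi
  have hi0 : i ≠ 0 := (lt_of_lt_of_le (pos_iff_ne_zero.2 ht0) (le_iInf₂ hno)).ne'
  have hiT : i ≠ ⊤ := ne_top_of_le_ne_top (autWeight_ne_top G hconn o x)
    (iInf₂_le (f := fun z (_ : z ∈ openCluster ω x) => autWeight G o z) x (mem_openCluster_self ω x))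
  have hΔ0 := minNbrWeight_ne_zero hconn o
  have hΔT := minNbrWeight_ne_top hconn ht hU o
  have hlt : i < i / minNbrWeight G o := by
    rw [ENNReal.lt_div_iff_mul_lt (Or.inl hΔ0) (Or.inl hΔT)]
    calc i * minNbrWeight G o < i * 1 :=
          ENNReal.mul_lt_mul_right hi0 hiT (minNbrWeight_lt_one hconn ht hU o)
      _ = i := mul_one i
  rw [hi, iInf_lt_iff] at hlt
  obtain ⟨v, hvlt⟩ := hlt
  rw [iInf_lt_iff] at hvlt
  obtain ⟨hv, hvlt⟩ := hvlt
  have hC : openCluster ω v = openCluster ω x := openCluster_eq_openCluster_of_mem hv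
  refine hω v (hC ▸ hH) fun z hz => ?_
  rw [hC] at hz
  calc minNbrWeight G o * autWeight G o v < minNbrWeight G o * (i / minNbrWeight G o) :=
        ENNReal.mul_lt_mul_right hΔ0 hΔT hvlt
    _ = i := ENNReal.mul_div_cancel hΔ0 hΔT
    _ ≤ autWeight G o z := iInf₂_le (f := fun z (_ : z ∈ openCluster ω x) => autWeight G o z) z hz

end Unbounded

/-! ### Lemma 5.2 -/

section LemmaFiveTwo

variable [Countable V] {G : SimpleGraph V} [G.LocallyFinite]

omit [Countable V] in
/-- **A connected piece avoiding a slab of width `a ≤ Δ b` and containing a vertex above it lies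
entirely above it** (closed-set form of the separation property, for configurations
`ω ⊆ E(G)`). [cite: Timar2006, §5 ("a slab separates the levels below it from the levels above it")] -/
theorem forall_lt_autWeight_of_disjoint_weightSlab (hconn : G.Connected) (ht : IsGraphTransitive G)
    (hU : ¬ IsGraphUnimodular G) {o : V} {a b : ℝ≥0∞} (hab : a ≤ minNbrWeight G o * b)
    {ω : BondConfig V} (hω : ω ⊆ G.edgeSet) {z : V} (hz : b < autWeight G o z)
    (hdisj : Disjoint (openCluster ω z) (weightSlab G o a b)) :
    ∀ y ∈ openCluster ω z, b < autWeight G o y := by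
  refine openCluster_subset_of_forall_mem' (S := {y | b < autWeight G o y}) hz fun u c hu huS huc hne => ?_
  have hadj : G.Adj u c := by have := hω huc; rwa [SimpleGraph.mem_edgeSet] at this
  have hc : c ∈ openCluster ω z := mem_openCluster_of_adj hu huc hne
  have hcL : c ∉ weightSlab G o a b := Set.disjoint_left.1 hdisj hc
  change b < autWeight G o c
  by_contra hcb
  rw [not_lt] at hcb
  have hca : autWeight G o c ≤ a := by
    by_contra h
    exact hcL ⟨not_le.1 h, hcb⟩
  -- `a ≤ Δ b < Δ w(u) ≤ w(c) ≤ a`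
  have h1 : minNbrWeight G o * b < minNbrWeight G o * autWeight G o u :=
    ENNReal.mul_lt_mul_right (minNbrWeight_ne_zero hconn o) (minNbrWeight_ne_top hconn ht hU o) huS
  have h2 := minNbrWeight_mul_le_of_adj hconn ht o hadj
  exact absurd (hab.trans_lt (h1.trans_le (h2.trans hca))) (lt_irrefl a)

omit [Countable V] in
/-- **… and one containing a vertex of weight `≤ a` lies entirely at weight `≤ a`.**
[cite: Timar2006, §5 ("a slab separates the levels below it from the levels above it")] -/
theorem forall_autWeight_le_of_disjoint_weightSlab (hconn : G.Connected) (ht : IsGraphTransitive G)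
    (hU : ¬ IsGraphUnimodular G) {o : V} {a b : ℝ≥0∞} (hab : a ≤ minNbrWeight G o * b)
    {ω : BondConfig V} (hω : ω ⊆ G.edgeSet) {z : V} (hz : autWeight G o z ≤ a)
    (hdisj : Disjoint (openCluster ω z) (weightSlab G o a b)) :
    ∀ y ∈ openCluster ω z, autWeight G o y ≤ a := by
  refine openCluster_subset_of_forall_mem' (S := {y | autWeight G o y ≤ a}) hz fun u c hu huS huc hne => ?_
  have hadj : G.Adj u c := by have := hω huc; rwa [SimpleGraph.mem_edgeSet] at this
  have hc : c ∈ openCluster ω z := mem_openCluster_of_adj hu huc hne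
  have hcL : c ∉ weightSlab G o a b := Set.disjoint_left.1 hdisj hc
  change autWeight G o c ≤ a
  by_contra hca
  rw [not_le] at hca
  have hcb : b < autWeight G o c := by
    by_contra h
    exact hcL ⟨hca, not_lt.1 h⟩
  -- `Δ w(c) ≤ w(u) ≤ a ≤ Δ b < Δ w(c)`
  have h1 : minNbrWeight G o * b < minNbrWeight G o * autWeight G o c :=
    ENNReal.mul_lt_mul_right (minNbrWeight_ne_zero hconn o) (minNbrWeight_ne_top hconn ht hU o) hcb
  have h2 := minNbrWeight_mul_le_of_adj hconn ht o hadj.symm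
  exact absurd ((h2.trans huS).trans hab) (not_le.2 h1)

/-- **Timár 2006, Lemma 5.2, PROVED** — "A heavy cluster intersects every slab in infinitely
many vertices." On a connected, locally finite, transitive nonunimodular graph, under
Bernoulli(`p`) bond percolation with `0 < p < 1`, for every slab `L = {a < w ≤ b}` with
`a ≤ Δ b`, `0 < b < ∞`: almost surely every heavy open cluster meets `L` in infinitely many
vertices. Proof as printed: if `C(x) ∩ L = K` were finite, closing the edges at `K` (deletion
tolerance) would leave a heavy piece of `C(x) ∖ K` missing `L`, hence entirely above or entirely
below `L` (the slab separates) — a heavy cluster bounded below resp. above in weight, which is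
almost surely absent (`ae_exists_autWeight_lt`, `ae_exists_lt_autWeight`).
[cite: Timar2006, Lemma 5.2] -/
theorem ae_infinite_inter_weightSlab (hconn : G.Connected) (ht : IsGraphTransitive G)
    (hU : ¬ IsGraphUnimodular G) {p : unitInterval} (hp0 : 0 < (p : ℝ)) (hp1 : (p : ℝ) < 1) (o : V)
    {a b : ℝ≥0∞} (hab : a ≤ minNbrWeight G o * b) (hb0 : b ≠ 0) (hbT : b ≠ ⊤) :
    ∀ᵐ ω ∂(bondPercolation G p), ∀ x, IsHeavy G o (openCluster ω x) →
      (openCluster ω x ∩ weightSlab G o a b).Infinite := by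
  classical
  set μ := bondPercolation G p with hμ
  set L := weightSlab G o a b with hL
  have haT : a ≠ ⊤ :=
    ne_top_of_le_ne_top (ENNReal.mul_ne_top (minNbrWeight_ne_top hconn ht hU o) hbT) hab
  -- the two null events fed by the surgery
  set Up : V → Set (BondConfig V) := fun z =>
    {ω | IsHeavy G o (openCluster ω z) ∧ ∀ y ∈ openCluster ω z, b < autWeight G o y} with hUp
  set Down : V → Set (BondConfig V) := fun z =>
    {ω | IsHeavy G o (openCluster ω z) ∧ ∀ y ∈ openCluster ω z, autWeight G o y ≤ a} with hDown
  have hnull : ∀ z, μ (Up z ∪ Down z) = 0 := by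
    intro z
    refine measure_union_null ?_ ?_
    · refine measure_mono_null (fun ω hω => ?_) (ae_iff.1 (ae_exists_autWeight_lt hconn ht hU hp0 hp1 o))
      intro hall
      obtain ⟨y, hy, hyb⟩ := hall z hω.1 b hb0
      exact absurd (hω.2 y hy) (not_lt.2 hyb.le)
    · refine measure_mono_null (fun ω hω => ?_) (ae_iff.1 (ae_exists_lt_autWeight hconn ht hU hp0 hp1 o))
      intro hall
      obtain ⟨y, hy, hya⟩ := hall z hω.1 a haT
      exact absurd (hω.2 y hy) (not_le.2 hya)
  have hmeas : ∀ z, MeasurableSet (Up z ∪ Down z) := fun z =>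
    (measurableSet_isHeavy_and_forall_mem o z _).union (measurableSet_isHeavy_and_forall_mem o z _)
  -- it suffices to treat one `x` and one finite value `K` of `C(x) ∩ L`
  rw [ae_all_iff]
  intro x
  set B : Finset V → Set (BondConfig V) := fun K =>
    {ω | IsHeavy G o (openCluster ω x) ∧ openCluster ω x ∩ L = ↑K} with hB
  suffices hBK : ∀ K, μ (B K) = 0 by
    have h0 : μ (⋃ K, B K) = 0 := measure_iUnion_null hBK
    filter_upwards [measure_eq_zero_iff_ae_notMem.1 h0] with ω hω hH
    by_contra hfin
    rw [Set.not_infinite] at hfin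
    exact hω (Set.mem_iUnion.2 ⟨hfin.toFinset, hH, by rw [Set.Finite.coe_toFinset]⟩)
  intro K
  by_contra hne
  set F : Finset (Sym2 V) := edgesAt G K with hF
  set N : Finset V := insert x (K.biUnion fun k => G.neighborFinset k) with hN
  -- on `B K ∩ {ω ⊆ E(G)}` the deletion lands in some `Up z ∪ Down z`, `z ∈ N`
  have hcover : B K ∩ {ω | ω ⊆ G.edgeSet} ⊆ ⋃ z ∈ (↑N : Set V), closeEdges ↑F ⁻¹' (Up z ∪ Down z) := by
    rintro ω ⟨⟨hH, hK⟩, hωE⟩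
    set ω' := closeEdges ↑F ω with hω'
    have hω'E : ω' ⊆ G.edgeSet := (closeEdges_subset _ ω).trans hωE
    obtain ⟨z, hzN, hz⟩ := hH.exists_isHeavy_inter hconn K.finite_toSet N
      (fun z => openCluster ω' z) (openCluster_subset_closeEdges_edgesAt hωE x)
    obtain ⟨hzK, hheavy, hdisjK, hsub⟩ := closeEdges_edgesAt_piece hconn hωE hz
    have hdisjL : Disjoint (openCluster ω' z) L := by
      rw [Set.disjoint_left]
      intro y hy hyL
      have : y ∈ (↑K : Set V) := by rw [← hK]; exact ⟨hsub hy, hyL⟩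
      exact Set.disjoint_left.1 hdisjK hy this
    refine Set.mem_biUnion (Finset.mem_coe.2 hzN) ?_
    change ω' ∈ Up z ∪ Down z
    have hzL : z ∉ L := Set.disjoint_left.1 hdisjL (mem_openCluster_self ω' z)
    by_cases hzb : b < autWeight G o z
    · exact Or.inl ⟨hheavy, forall_lt_autWeight_of_disjoint_weightSlab hconn ht hU hab hω'E hzb hdisjL⟩
    · have hza : autWeight G o z ≤ a := by
        by_contra h
        exact hzL ⟨not_le.1 h, not_lt.1 hzb⟩
      exact Or.inr ⟨hheavy, forall_autWeight_le_of_disjoint_weightSlab hconn ht hU hab hω'E hza hdisjL⟩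
  have hpos : μ (⋃ z ∈ (↑N : Set V), closeEdges ↑F ⁻¹' (Up z ∪ Down z)) ≠ 0 := fun h0 =>
    measure_inter_ne_zero_of_ae hne setBernoulli_ae_subset (measure_mono_null hcover h0)
  rw [Ne, measure_biUnion_null_iff N.countable_toSet, not_forall] at hpos
  obtain ⟨z, hz⟩ := hpos
  rw [Classical.not_imp] at hz
  obtain ⟨-, hz⟩ := hz
  -- deletion tolerance contradicts `μ (Up z ∪ Down z) = 0`
  have hpos₁ : 0 < μ.real (Up z ∪ Down z) :=
    bondPercolation_real_pos_of_closeEdges G hp1 F (hmeas z)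
      (ENNReal.toReal_pos hz (measure_ne_top _ _)) fun ω hω => hω
  rw [measureReal_def, hnull z, ENNReal.toReal_zero] at hpos₁
  exact lt_irrefl _ hpos₁

end LemmaFiveTwo

end Literature.Barriers.CriticalPhenomena

end
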